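import Literature.MathematicalPhysics.QuantumFieldTheory.King1986.MinimizerAliasRateDeriv
import Literature.MathematicalPhysics.QuantumFieldTheory.King1986.MinimizerBlockDecay
import HarnessLib

/-!
# King 1986, Proposition 3.8 (3.71), SECOND LINE — the lattice DERIVATIVE `∂^η_μ` of the block-spin minimiser kernel —
# ON THE TORUS for the ACTUAL operators: `|a_{k+n}∂^{η′}_μG^{η′}_{k+n}Q^*_{k+n}(x′, z) − a_k∂^η_μG^η_kQ^*_k(x, z)|
# ≦ CL^{−γk}exp[−δ₀|x − z|]`, sup-norm rate, Theorem 3.3's derivative clause, and the printed shape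

**Citation header (reproduction of PUBLISHED and PROVED work; seat `pub-ymgap-dag-n18-b` (g2) of the cell `pub-ymgap`,
Track-A node N18 = NE5 whose PRINTED MODEL of record is King's Prop. 3.8 ∕ 3.9; tenth file of the seat's chain, the
torus assembly of `MinimizerAliasRateDeriv` (momentum-space core of the derivative line) exactly as `MinimizerTwoSpacing`
∕ `MinimizerTwoSpacingDecay` ∕ `MinimizerBlockDecay` assembled `MinimizerAliasRate` for the first line.)**
C. King, *The U(1) Higgs model. I. The continuum limit*, Commun. Math. Phys. **102** (1986) 649–677 [King1986], §3.4
Proposition 3.8 (3.71) p. 664, second line; Theorem 3.3 (3.7) p. 658 «|(D^ηG_k(Ω, A)f)(x)| ≤ C exp[−δ₀dist(x, supp f)]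
‖f‖_∞»; §4 (4.1)–(4.5) p. 670, (4.19)–(4.27) pp. 672–673, p. 674 «combining our bounds with Theorem 3.3 we deduce
(3.71)».  T. Bałaban, *Regularity and decay of lattice Green's functions*, CMP **89** (1983) [Balaban1983RegularityDecay],
Theorem (1.10) p. 573 (`|(D^η_μG_k(Ω,A)f)(x)|, |(G_k(Ω,A)f)(x)| ≤ c₀exp(−δ₀dist(x, supp f))‖f‖_∞` — BOTH clauses are
certified on the torus by lit-balaban's `B4Thm110ZeroTorus.thm110_zero_torus`; the first-line files used clause 1, this
file uses clause 2).  Page images READ AS IMAGES by this seat: `b2b-balaban-template/king-renders/1986-cmp102-king-u1-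
higgs-I-p016-x2.png` (p. 664), `…-p024-x2.png` (p. 672).  King's paper is TEMPLATE LITERATURE (printed and proved
`A = 0` mechanism); nothing here is about Bałaban's covariant objects.

**What this file PROVES (kernel; 0 `def`).**  `ℋ_k = minimiser N M a_k N² m²` (`N = L^k`, the ACTUAL operator of
`EffectiveLaplacianSymbol`), King's lattice derivative in unit-lattice units `∂^η_μℋ_k(x, b) = N·(ℋ_k(x + e_μ, b) −
ℋ_k(x, b))` (`η⁻¹ = L^k = N`):
* §1 `modePhase_pos_shift` (a lattice step multiplies the mode of alias momentum `Q` by `e^{iQ_μ∕N}`), `fdq_inv_neg`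
  (`N(e^{iQ_μ∕N} − 1) = fdq N⁻¹ (−Q_μ)`), and **`dminimiser_kernel_eq_digitSum`**: for odd `N`,
  `∂^η_μℋ_k(x, b) = |Ω|⁻¹ Σ_q e^{−iq·b} Σ_{j ∈ digitBox} dmodeTerm (Δ^{(k)}(p′)) N⁻¹ m² (p′ + 2πj) (x∕N) μ` — (4.19) with
  the factor `η⁻¹{exp[iη(p′+l)_μ] − 1}` for the actual torus operators.
* §2 **`king_prop38_deriv_torus`** — the sup-norm two-spacing rate: for odd `L ≥ 2`, `k, n ≥ 1`, `a > 0`, `m² > 0`,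
  `0 ≤ γ < 1`, every unit torus, `x′` over `x`, every `b`, `μ`:
  `|∂^{η′}_μℋ_{k+n}(x′, b) − ∂^η_μℋ_k(x, b)| ≤ (C₁′ + C₂′)·L^{−γk}`, `C₁′ = dprop38RateConst a a θ (π²∕4)^d d γ`,
  `C₂′ = dprop38PosConst a (π²∕4)^d d γ`, `θ = lemma43Const a L k n`, by `king_prop38_deriv_aliasSums` at `δ = L^{−k}`.
* §3 Theorem 3.3's DERIVATIVE clause for `ℋ_K` through the bridge: `eps_inv_eq`, `dminimiser_toTor_eq`
  (`∂^ηℋ_K(toTor x, toTorUnit b) = a_K·(∂^ε_μG_K(T_ε,0)Q_K^*δ_b)(x)`), **`dminimiser_kernel_decay_blocks`**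
  (`|∂^η_μℋ_K(x, b)| ≤ a_K·c₀·e^{−δ₀·tdistT M (B(x)) b}` on Bałaban's volumes, every `x`, `b`, `μ`, via
  `thm110_zero_torus` clause 2 and the slack geometry of `MinimizerBlockDecay`).
* §4 «combining our bounds with Theorem 3.3»: `king_prop38_deriv_torus_of_decay` (interpolation) and
  **`king_prop38_deriv_torus_blocks`** — (3.71) line 2 in King's block-distance currency, UNCONDITIONAL on Bałaban's
  volumes: `|∂^{η′}_μℋ_{K+n}(x′, b) − ∂^η_μℋ_K(x, b)| ≤ √(2ac₀(C₁′ + C₂′)L^{−γK})·e^{−(δ₀∕2)·tdistT M (B(x)) b}`; §5 the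
  read-out shapes at a common smaller rate (`dminimiser_row_decay`, `dminimiser_row_rate`).

**NOT COVERED.**  The Hölder-quotient lines 3–4 of (3.71); unit tori other than `2L^m` for the decay (the sup rate §2
holds for every unit torus); even `L`; `A ≠ 0`.  HONEST FRAMING: King's `A = 0` scalar MODEL of the NE5 «η-rate»
mechanism — template literature on a finite torus; nothing about Bałaban's covariant objects; nothing continuum ∕
mass-gap ∕ Clay; count-neutral for the cell's 27 nodes.
-/

noncomputable section

open Finset Real Matrix
open scoped BigOperators ComplexConjugate

namespace Literature.MathematicalPhysics.QuantumFieldTheory.King1986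

open Literature.MathematicalPhysics.QuantumFieldTheory.Balaban1983to89 (Params)
open Literature.MathematicalPhysics.QuantumFieldTheory.Balaban1983to89.B5Prop11Plancherel
open Literature.MathematicalPhysics.QuantumFieldTheory.Balaban1983to89.B1RG242Torus
  (lvl lvl_of_le tower Qks deriv deriv_mulVec extMat_mulVec)
open Literature.MathematicalPhysics.QuantumFieldTheory.Balaban1983to89.B5Ineq137Torus (T blk)

namespace Torus

variable {d : ℕ}

/-! ## §1 The lattice derivative of the minimiser kernel as King's digit sum (4.19) with the factor `η⁻¹(e^{iηQ_μ} − 1)` -/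

section DigitSum

variable (N : ℕ) [NeZero N] (M : Fin d → ℕ) [hM : ∀ μ, NeZero (M μ)]

/-- **A lattice step multiplies a mode by `e^{iQ_μ∕N}`**: for odd `N` and a digit `w`, the mode phase of alias momentum
`Q = p′ + 2πw` at the position `(x + e_μ)∕N` equals the phase at `x∕N` times `exp(iQ_μ∕N)` (the torus character of the
fibre momentum is multiplicative and `Nθ_μ = Q_μ`; wrap-around is invisible). [cite: King1986, (4.1)–(4.2) p.670, (4.19) p.672] -/
theorem modePhase_pos_shift (hN : Odd N) (q : Tor M) {w : Fin d → ℤ} (hw : w ∈ digitBox d N)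
    (x : Tor (fine N M)) (μ : Fin d) :
    modePhase (aliasPt (sOf M q) w) (fun ν => (((x + unitVec (fine N M) μ) ν).val : ℝ) / N)
      = modePhase (aliasPt (sOf M q) w) (fun ν => ((x ν).val : ℝ) / N)
        * Complex.exp (Complex.I * (((N : ℝ)⁻¹ * aliasPt (sOf M q) w μ : ℝ) : ℂ)) := by
  have hNr : (N : ℝ) ≠ 0 := by exact_mod_cast NeZero.ne N
  set p := aliasMom N M q w with hp_def
  have hp : p ∈ fib N M q := aliasMom_mem_fib N M q w
  have hdig : digit N M q p = w := digit_aliasMom N M hN q hw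
  rw [← hdig, ← chi_fine_eq_modePhase N M hp, ← chi_fine_eq_modePhase N M hp, chi_add_right,
    chi_unitVec_eq_exp]
  congr 1
  have hs : sOf (fine N M) p μ = (N : ℝ)⁻¹ * aliasPt (sOf M q) (digit N M q p) μ := by
    rw [← natMul_sOf_fine_eq_aliasPt N M hp μ, ← mul_assoc, inv_mul_cancel₀ hNr, one_mul]
  rw [hs, mul_comm]

/-- King's factor: `N·(e^{iQ_μ∕N} − 1) = η⁻¹(e^{iηQ_μ} − 1)` with `η = N⁻¹`, i.e. the tree's `fdq N⁻¹ (−Q_μ)`.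
[cite: King1986, (4.19) p.672] -/
theorem fdq_inv_neg (Nr : ℝ) (t : ℝ) :
    fdq Nr⁻¹ (-t) = (Nr : ℂ) * (Complex.exp (Complex.I * ((Nr⁻¹ * t : ℝ) : ℂ)) - 1) := by
  unfold fdq
  rw [show -(Nr⁻¹ * -t) = Nr⁻¹ * t by ring, Complex.ofReal_inv, div_inv_eq_mul, mul_comm]

/-- **THE LATTICE DERIVATIVE OF THE MINIMISER KERNEL AS KING'S DOUBLE SUM (4.19)** on the torus (odd `N`, `c = N²`,
`a > 0`, `m² > 0`): `N·(ℋ_k(x + e_μ, b) − ℋ_k(x, b)) = |Ω|⁻¹ Σ_q e^{−iq·b} Σ_{j ∈ digitBox} Δ^{(k)}(p′)·u^η(Q)·Δ^η(Q)⁻¹·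
e^{iQ·ξ}·η⁻¹(e^{iηQ_μ} − 1)` with `Q = p′ + 2πj`, `ξ = x∕N`, `η = N⁻¹` — the first line's digit sum
(`minimiser_kernel_eq_digitSum`) at `x + e_μ` and at `x`, differenced mode by mode (`modePhase_pos_shift`).
[cite: King1986, (4.19) p.672] -/
theorem dminimiser_kernel_eq_digitSum (hN : Odd N) (hN1 : 1 ≤ N) {a m2 : ℝ} (ha : 0 < a) (hm : 0 < m2)
    (b : Tor M) (x : Tor (fine N M)) (μ : Fin d) :
    (((N : ℝ) * (minimiser N M a ((N : ℝ) ^ 2) m2 (Pi.single b 1) (x + unitVec (fine N M) μ)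
        - minimiser N M a ((N : ℝ) ^ 2) m2 (Pi.single b 1) x) : ℝ) : ℂ)
      = (Fintype.card (Tor M) : ℂ)⁻¹
        * ∑ q : Tor M, conj (chi M q b)
            * ∑ w ∈ digitBox d N, dmodeTerm (DeltaEff a N m2 (sOf M q)) (N : ℝ)⁻¹ m2 (aliasPt (sOf M q) w)
                (fun ν => ((x ν).val : ℝ) / N) μ := by
  push_cast
  rw [minimiser_kernel_eq_digitSum N M hN hN1 ha hm b (x + unitVec (fine N M) μ),
    minimiser_kernel_eq_digitSum N M hN hN1 ha hm b x, ← mul_sub, ← Finset.sum_sub_distrib, mul_left_comm,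
    Finset.mul_sum]
  congr 1
  refine Finset.sum_congr rfl fun q _ => ?_
  rw [← mul_sub, ← Finset.sum_sub_distrib, mul_left_comm, Finset.mul_sum]
  congr 1
  refine Finset.sum_congr rfl fun w hw => ?_
  rw [dmodeTerm, fdq_inv_neg (N : ℝ), modeTerm, modeTerm, modePhase_pos_shift N M hN q hw x μ]
  push_cast
  ring

end DigitSum

/-! ## §2 Proposition 3.8 (3.71), second line, on the torus: the sup-norm two-spacing rate of `∂^η_μℋ_k` -/

/-- **KING'S PROPOSITION 3.8, SECOND LINE OF (3.71), ON THE TORUS, SUP-NORM FORM, FOR THE ACTUAL OPERATORS.**  Let `L`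
be odd, `L ≥ 2`, `k, n ≥ 1`, `a > 0`, `m² > 0`, `Ω = Π_μ ℤ∕M_μ` any unit torus, `ℋ_k = minimiser (L^k) M a_k L^{2k} m²`,
`ℋ_{k+n} = minimiser (L^nL^k) M a_{k+n} (L^nL^k)² m²` King's kernels `a_kG^η_kQ^*_k`, `a_{k+n}G^{η′}_{k+n}Q^*_{k+n}` and
`∂^η_μℋ(x, b) = η⁻¹(ℋ(x + e_μ, b) − ℋ(x, b))` their forward lattice derivatives (`η⁻¹ = L^k`, `η′⁻¹ = L^nL^k`).  If
`x′ ∈ T_{η′}` lies over `x ∈ T_η` (`x_ν = ⌊x′_ν∕L^n⌋`), then for every unit site `b`, every `μ` and every `0 ≤ γ < 1`: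
`|∂^{η′}_μℋ_{k+n}(x′, b) − ∂^η_μℋ_k(x, b)| ≤ (C₁′ + C₂′)·L^{−γk}` uniformly in `x′`, `b`, `M`, `m²`, `n` — King's (3.71),
second line, before «combining with Theorem 3.3»: both derivatives are the digit sums (4.19)
(`dminimiser_kernel_eq_digitSum`, `sum_digitBox_mul`), and for every reduced momentum the alias sums of the difference
obey `king_prop38_deriv_aliasSums` with `|x − x′| ≤ L^{−k}`. [cite: King1986, Prop. 3.8 (3.71) p.664; (4.19)–(4.27) pp.672–673] -/
theorem king_prop38_deriv_torus (hd : 0 < d) {L : ℕ} [NeZero L] (hLodd : Odd L) (hL : 2 ≤ L) {k n : ℕ} (hk : 1 ≤ k)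
    (hn : 1 ≤ n) (M : Fin d → ℕ) [hM : ∀ μ, NeZero (M μ)] {a m2 : ℝ} (ha : 0 < a) (hm : 0 < m2)
    {γ : ℝ} (hγ0 : 0 ≤ γ) (hγ1 : γ < 1) (b : Tor M) (x : Tor (fine (L ^ k) M))
    (x' : Tor (fine (L ^ n * L ^ k) M)) (hx : ∀ μ, (x μ).val = (x' μ).val / L ^ n) (μ : Fin d) :
    |((L ^ n * L ^ k : ℕ) : ℝ)
        * (minimiser (L ^ n * L ^ k) M (aK a L (k + n)) (((L ^ n * L ^ k : ℕ) : ℝ) ^ 2) m2 (Pi.single b 1)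
            (x' + unitVec (fine (L ^ n * L ^ k) M) μ)
          - minimiser (L ^ n * L ^ k) M (aK a L (k + n)) (((L ^ n * L ^ k : ℕ) : ℝ) ^ 2) m2 (Pi.single b 1) x')
      - ((L ^ k : ℕ) : ℝ)
        * (minimiser (L ^ k) M (aK a L k) (((L ^ k : ℕ) : ℝ) ^ 2) m2 (Pi.single b 1) (x + unitVec (fine (L ^ k) M) μ)
          - minimiser (L ^ k) M (aK a L k) (((L ^ k : ℕ) : ℝ) ^ 2) m2 (Pi.single b 1) x)|
      ≤ (dprop38RateConst a a (lemma43Const a L k n) ((π ^ 2 / 4) ^ d) d γ + dprop38PosConst a ((π ^ 2 / 4) ^ d) d γ)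
        * ((L ^ k : ℕ) : ℝ) ^ (-γ) := by
  -- elementary facts
  have hLr : (1 : ℝ) < L := by exact_mod_cast (lt_of_lt_of_le one_lt_two hL)
  have hNodd : Odd (L ^ k) := hLodd.pow
  have hRodd : Odd (L ^ n) := hLodd.pow
  have hN'odd : Odd (L ^ n * L ^ k) := hRodd.mul hNodd
  have hN1 : 1 ≤ L ^ k := Nat.one_le_pow _ _ (by omega)
  have hR1 : 1 ≤ L ^ n := Nat.one_le_pow _ _ (by omega)
  have hN'1 : 1 ≤ L ^ n * L ^ k := Nat.one_le_iff_ne_zero.mpr (mul_ne_zero (by omega) (by omega))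
  have haA : 0 < aK a L k := aK_pos ha hLr hk
  have haB : 0 < aK a L (k + n) := aK_pos ha hLr (by omega)
  have hNr : (0 : ℝ) < ((L ^ k : ℕ) : ℝ) := by exact_mod_cast (show 0 < L ^ k by omega)
  have hcard : (Fintype.card (Tor M) : ℝ) ≠ 0 := by exact_mod_cast Fintype.card_ne_zero
  -- the positions in unit-lattice coordinates are `L^{-k}`-close
  have hξξ : ∀ ν, |((x' ν).val : ℝ) / ((L ^ n * L ^ k : ℕ) : ℝ) - ((x ν).val : ℝ) / ((L ^ k : ℕ) : ℝ)|
      ≤ (((L ^ k : ℕ) : ℝ))⁻¹ := fun ν => abs_pos_sub_le hN1 hR1 (hx ν)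
  -- the two derivatives as digit sums
  have hA := dminimiser_kernel_eq_digitSum (L ^ k) M hNodd hN1 haA hm b x μ
  have hB := dminimiser_kernel_eq_digitSum (L ^ n * L ^ k) M hN'odd hN'1 haB hm b x' μ
  -- the alias sums of one reduced momentum
  have hq : ∀ q : Tor M,
      ‖(∑ w ∈ digitBox d (L ^ n * L ^ k),
          dmodeTerm (DeltaEff (aK a L (k + n)) (L ^ n * L ^ k) m2 (sOf M q)) (((L ^ n * L ^ k : ℕ) : ℝ))⁻¹ m2
            (aliasPt (sOf M q) w) (fun ν => ((x' ν).val : ℝ) / ((L ^ n * L ^ k : ℕ) : ℝ)) μ)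
        - ∑ j ∈ digitBox d (L ^ k),
          dmodeTerm (DeltaEff (aK a L k) (L ^ k) m2 (sOf M q)) (((L ^ k : ℕ) : ℝ))⁻¹ m2 (aliasPt (sOf M q) j)
            (fun ν => ((x ν).val : ℝ) / ((L ^ k : ℕ) : ℝ)) μ‖
      ≤ (dprop38RateConst a a (lemma43Const a L k n) ((π ^ 2 / 4) ^ d) d γ
          + dprop38PosConst a ((π ^ 2 / 4) ^ d) d γ) * ((L ^ k : ℕ) : ℝ) ^ (-γ) := by
    intro q
    rw [show digitBox d (L ^ n * L ^ k) = digitBox d (L ^ k * L ^ n) by rw [Nat.mul_comm],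
      sum_digitBox_mul hNodd hRodd]
    refine (norm_digitSum_sub_le (N := L ^ k) (R := L ^ n)
      (fun w => dmodeTerm (DeltaEff (aK a L (k + n)) (L ^ n * L ^ k) m2 (sOf M q)) (((L ^ n * L ^ k : ℕ) : ℝ))⁻¹ m2
        (aliasPt (sOf M q) w) (fun ν => ((x' ν).val : ℝ) / ((L ^ n * L ^ k : ℕ) : ℝ)) μ)
      (fun j => dmodeTerm (DeltaEff (aK a L k) (L ^ k) m2 (sOf M q)) (((L ^ k : ℕ) : ℝ))⁻¹ m2 (aliasPt (sOf M q) j)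
        (fun ν => ((x ν).val : ℝ) / ((L ^ k : ℕ) : ℝ)) μ)).trans ?_
    have hK := king_prop38_deriv_aliasSums hd ha hL hk hn hm hγ0 hγ1 (abs_sOf_le M q)
      (J := digitBox d (L ^ k)) (B := digitBox d (L ^ n))
      (fun j hj ν => two_abs_lt_of_mem_digitBox (L ^ k) hNodd hj ν)
      (fun c hc ν => two_abs_lt_of_mem_digitBox (L ^ n) hRodd hc ν)
      (ξ := fun ν => ((x ν).val : ℝ) / ((L ^ k : ℕ) : ℝ))
      (ξ' := fun ν => ((x' ν).val : ℝ) / ((L ^ n * L ^ k : ℕ) : ℝ))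
      (inv_nonneg.mpr hNr.le) hξξ μ
    rw [← Nat.cast_mul] at hK
    refine hK.trans (le_of_eq ?_)
    rw [Real.inv_rpow hNr.le, ← Real.rpow_neg hNr.le]
    ring
  -- the difference of the two derivatives as `|Ω|⁻¹ Σ_q e^{−iq·b}(S_B(q) − S_A(q))`
  have hdiff : ((((L ^ n * L ^ k : ℕ) : ℝ)
        * (minimiser (L ^ n * L ^ k) M (aK a L (k + n)) (((L ^ n * L ^ k : ℕ) : ℝ) ^ 2) m2 (Pi.single b 1)
            (x' + unitVec (fine (L ^ n * L ^ k) M) μ)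
          - minimiser (L ^ n * L ^ k) M (aK a L (k + n)) (((L ^ n * L ^ k : ℕ) : ℝ) ^ 2) m2 (Pi.single b 1) x')
      - ((L ^ k : ℕ) : ℝ)
        * (minimiser (L ^ k) M (aK a L k) (((L ^ k : ℕ) : ℝ) ^ 2) m2 (Pi.single b 1) (x + unitVec (fine (L ^ k) M) μ)
          - minimiser (L ^ k) M (aK a L k) (((L ^ k : ℕ) : ℝ) ^ 2) m2 (Pi.single b 1) x) : ℝ) : ℂ)
      = (Fintype.card (Tor M) : ℂ)⁻¹ * ∑ q : Tor M, conj (chi M q b)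
          * ((∑ w ∈ digitBox d (L ^ n * L ^ k),
              dmodeTerm (DeltaEff (aK a L (k + n)) (L ^ n * L ^ k) m2 (sOf M q)) (((L ^ n * L ^ k : ℕ) : ℝ))⁻¹ m2
                (aliasPt (sOf M q) w) (fun ν => ((x' ν).val : ℝ) / ((L ^ n * L ^ k : ℕ) : ℝ)) μ)
            - ∑ j ∈ digitBox d (L ^ k),
              dmodeTerm (DeltaEff (aK a L k) (L ^ k) m2 (sOf M q)) (((L ^ k : ℕ) : ℝ))⁻¹ m2
                (aliasPt (sOf M q) j) (fun ν => ((x ν).val : ℝ) / ((L ^ k : ℕ) : ℝ)) μ) := by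
    rw [Complex.ofReal_sub, hB, hA, ← mul_sub, ← Finset.sum_sub_distrib]
    congr 1
    refine Finset.sum_congr rfl fun q _ => ?_
    ring
  have hnorm : ∀ r : ℝ, |r| = ‖((r : ℝ) : ℂ)‖ := fun r => by rw [Complex.norm_real, Real.norm_eq_abs]
  have hchi : ∀ q : Tor M, ‖conj (chi M q b)‖ = 1 := fun q => by
    rw [conj_chi]; unfold chi; rw [norm_prod]
    exact Finset.prod_eq_one fun μ _ => by rw [ZMod.stdAddChar_apply, Circle.norm_coe]
  rw [hnorm, hdiff, norm_mul, norm_inv, Complex.norm_natCast]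
  set Bd : ℝ := (dprop38RateConst a a (lemma43Const a L k n) ((π ^ 2 / 4) ^ d) d γ
      + dprop38PosConst a ((π ^ 2 / 4) ^ d) d γ) * ((L ^ k : ℕ) : ℝ) ^ (-γ) with hBd
  have hsum : ‖∑ q : Tor M, conj (chi M q b)
        * ((∑ w ∈ digitBox d (L ^ n * L ^ k),
            dmodeTerm (DeltaEff (aK a L (k + n)) (L ^ n * L ^ k) m2 (sOf M q)) (((L ^ n * L ^ k : ℕ) : ℝ))⁻¹ m2
              (aliasPt (sOf M q) w) (fun ν => ((x' ν).val : ℝ) / ((L ^ n * L ^ k : ℕ) : ℝ)) μ)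
          - ∑ j ∈ digitBox d (L ^ k),
            dmodeTerm (DeltaEff (aK a L k) (L ^ k) m2 (sOf M q)) (((L ^ k : ℕ) : ℝ))⁻¹ m2
              (aliasPt (sOf M q) j) (fun ν => ((x ν).val : ℝ) / ((L ^ k : ℕ) : ℝ)) μ)‖
      ≤ ∑ _q : Tor M, Bd := by
    refine (norm_sum_le _ _).trans (Finset.sum_le_sum fun q _ => ?_)
    rw [norm_mul, hchi q, one_mul]
    exact hq q
  calc (Fintype.card (Tor M) : ℝ)⁻¹ * _ ≤ (Fintype.card (Tor M) : ℝ)⁻¹ * ∑ _q : Tor M, Bd :=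
        mul_le_mul_of_nonneg_left hsum (by positivity)
    _ = Bd := by
        rw [Finset.sum_const, Finset.card_univ, nsmul_eq_mul, ← mul_assoc, inv_mul_cancel₀ hcard, one_mul]

/-! ## §3 Theorem 3.3's DERIVATIVE clause for `ℋ_K`, through the bridge to the B1∕B4 tower -/

section Bridge

variable (P : Params) (M : Fin P.d → ℕ) [hM : ∀ μ, NeZero (M μ)]

omit hM in
/-- `ε⁻¹ = L^K` for the volume `P`. [cite: Balaban1987RG1, (0.1) p.251] -/
theorem eps_inv_eq : P.eps⁻¹ = ((P.L ^ P.K : ℕ) : ℝ) := by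
  rw [Params.eps, inv_pow, inv_inv]; push_cast; rfl

/-- **KING'S `∂^η_μℋ_K` IS BAŁABAN'S `a_K∂^ε_μG_K(T_ε,0)Q_K^*`**: with `N = L^K = ε⁻¹`,
`ε⁻¹·(ℋ_K(toTor x + e_μ, toTorUnit b) − ℋ_K(toTor x, toTorUnit b)) = a_K·((∂^ε_μ G_K(T_ε,0)) Q_K^*δ_b)(x)` — the
bridge `minimiser_toTor_eq` at `x` and `x + e_μ` (`toTor_shift`) and B1's (1.4) `deriv_mulVec`.
[cite: King1986, (2.13)–(2.15) p.653, Theorem 3.3 (3.7) p.658; Balaban1982Higgs1, (1.4) p.604] -/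
theorem dminimiser_toTor_eq (hMK : ∀ μ, M μ = P.sitesPerDir P.K) (a msq : ℝ) (b : Balaban1983to89.Site P P.K)
    (x : Balaban1983to89.Site P 0) (μ : Fin P.d) :
    P.eps⁻¹ * (minimiser (P.L ^ P.K) M (Balaban1983to89.B1.aSeq a P.L P.K) ((P.eps⁻¹) ^ 2) msq
          (Pi.single (toTorUnit P M hMK b) 1) (toTor P M hMK x + unitVec (fine (P.L ^ P.K) M) μ)
        - minimiser (P.L ^ P.K) M (Balaban1983to89.B1.aSeq a P.L P.K) ((P.eps⁻¹) ^ 2) msq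
          (Pi.single (toTorUnit P M hMK b) 1) (toTor P M hMK x))
      = Balaban1983to89.B1.aSeq a P.L P.K
        * ((deriv P 0 P.eps μ * (tower P a msq).G P.K) *ᵥ (Qks P P.K *ᵥ Pi.single b 1)) x := by
  rw [← toTor_shift P M hMK x μ, minimiser_toTor_eq P M hMK, minimiser_toTor_eq P M hMK, ← Matrix.mulVec_mulVec,
    deriv_mulVec]
  ring

end Bridge

/-- **UNIFORM EXPONENTIAL DECAY OF THE LATTICE DERIVATIVE OF KING'S MINIMISER KERNEL, IN THE UNIT-TORUS DISTANCE FROM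
THE BLOCK OF THE FINE POINT (King's Theorem 3.3 (3.7) ∕ Prop. 3.7, derivative clause, for `a_KD^ηG^η_KQ^*_K`,
`A = 0`).**  For `d ≥ 1`, odd `L > 1`, `a > 0`, `m² ≥ 0` there are `δ₀, c₀ > 0` (functions of `d, L, a, m²` only) such
that for EVERY volume `(d, L, m, K)` with `K ≥ 1`, the unit torus `M_μ = 2L^m`, every spelling `N = L^K`, EVERY fine
point `x`, unit site `b` and direction `μ`:  `|N·(ℋ_K(x + e_μ, b) − ℋ_K(x, b))| ≤ a_K·c₀·exp(−δ₀·tdistT M (B(x)) b)`.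
Input: clause 2 of [Ba 4] (1.10) on the torus (`B4Thm110ZeroTorus.thm110_zero_torus`, lit-balaban) with
`f = Q_K^*δ_b` (`‖f‖_∞ = 1`, `supp f = B(b)`) at `D := max 0 ((|B(x) − b| − 2)∕ε)` (`T_blk_le_eps_mul`), through
`dminimiser_toTor_eq`. [cite: King1986, Theorem 3.3 (3.7) p.658, Prop. 3.7 (3.64) p.663; Balaban1983RegularityDecay, Theorem (1.10) p.573] -/
theorem dminimiser_kernel_decay_blocks (dd L : ℕ) (hd : 1 ≤ dd) (hL : Odd L ∧ 1 < L) {a : ℝ} (ha : 0 < a)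
    {msq : ℝ} (hmsq : 0 ≤ msq) :
    ∃ δ₀ c₀ : ℝ, 0 < δ₀ ∧ 0 < c₀ ∧ ∀ (P : Params), P.d = dd → P.L = L → 1 ≤ P.K →
      ∀ (M : Fin P.d → ℕ) [∀ μ, NeZero (M μ)] (_hMK : ∀ μ, M μ = P.sitesPerDir P.K)
        (N : ℕ) [NeZero N] (_hN : N = P.L ^ P.K) (xt : Tor (fine N M)) (bt : Tor M) (μ : Fin P.d),
        |(N : ℝ) * (minimiser N M (aK a P.L P.K) (((N : ℕ) : ℝ) ^ 2) msq (Pi.single bt 1) (xt + unitVec (fine N M) μ)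
            - minimiser N M (aK a P.L P.K) (((N : ℕ) : ℝ) ^ 2) msq (Pi.single bt 1) xt)|
          ≤ aK a P.L P.K * c₀ * Real.exp (-(δ₀ * tdistT M (blockOf N M xt) bt)) := by
  obtain ⟨δ₀, c₀, hδ₀, hc₀, H⟩ := Balaban1983to89.B4Thm110ZeroTorus.thm110_zero_torus dd L hd hL ha hmsq
  refine ⟨δ₀, c₀ * Real.exp (2 * δ₀), hδ₀, by positivity, ?_⟩
  intro P hPd hPL hK M _ hMK N _ hN xt bt μ
  subst hN
  have hLr : (1 : ℝ) < P.L := by exact_mod_cast P.hL.2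
  have haK : 0 < Balaban1983to89.B1.aSeq a P.L P.K := Balaban1983to89.B1.aSeq_pos ha hLr hK
  -- preimages of the King-side points under the dictionaries
  set x : Balaban1983to89.Site P 0 := (torEquiv P M hMK).symm xt with hxdef
  set b : Balaban1983to89.Site P P.K := (torUnitEquiv P M hMK).symm bt with hbdef
  have hxt : toTor P M hMK x = xt := (torEquiv P M hMK).apply_symm_apply xt
  have hbt : toTorUnit P M hMK b = bt := (torUnitEquiv P M hMK).apply_symm_apply bt
  -- the slack distance fed to Theorem 3.3
  have hε : 0 < P.eps := Params.eps_pos P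
  set TK : ℝ := T P P.K (blk P P.K x) b with hTKdef
  set D : ℝ := max 0 ((TK - 2) / P.eps) with hDdef
  have hD0 : 0 ≤ D := le_max_left _ _
  have hDle : ∀ z : Balaban1983to89.Site P 0, Balaban1983to89.Site.proj P.K P.K z = b → D ≤ T P 0 x z := by
    intro z hz
    rcases le_total ((TK - 2) / P.eps) 0 with h | h
    · rw [hDdef, max_eq_left h]
      exact Balaban1983to89.B5Ineq137Torus.T_nonneg P 0 x z
    · rw [hDdef, max_eq_right h, div_le_iff₀ hε]
      have hdom := T_blk_le_eps_mul P x z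
      rw [blk_eq_proj P z, hz] at hdom
      linarith [mul_comm P.eps (T P 0 x z)]
  have hεD : TK - 2 ≤ P.eps * D := by
    have h1 : P.eps * ((TK - 2) / P.eps) ≤ P.eps * D :=
      mul_le_mul_of_nonneg_left (le_max_right _ _) hε.le
    rwa [mul_div_cancel₀ _ hε.ne'] at h1
  -- the source `f = Q_K^* δ_b` is the indicator of the block of `b`
  have hf : ∀ z : Balaban1983to89.Site P 0,
      (Qks P P.K *ᵥ (Pi.single b (1 : ℝ) : Balaban1983to89.Site P P.K → ℝ)) z
        = if Balaban1983to89.Site.proj P.K P.K z = b then 1 else 0 := by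
    intro z
    simp only [Qks]
    rw [extMat_mulVec, lvl_of_le P (Nat.le_add_left _ _), Pi.single_apply]
  have hF : ∀ z, |(Qks P P.K *ᵥ (Pi.single b (1 : ℝ) : Balaban1983to89.Site P P.K → ℝ)) z| ≤ 1 := by
    intro z; rw [hf z]; split_ifs <;> simp
  have hsupp : ∀ z, (Qks P P.K *ᵥ (Pi.single b (1 : ℝ) : Balaban1983to89.Site P P.K → ℝ)) z ≠ 0 →
      D ≤ T P 0 x z := by
    intro z hz
    rw [hf z] at hz
    by_cases hb : Balaban1983to89.Site.proj P.K P.K z = b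
    · exact hDle z hb
    · rw [if_neg hb] at hz; exact absurd rfl hz
  have hmain := (H P hPd hPL P.K hK le_rfl x _ 1 D hF hD0 hsupp).2 μ
  have hexp : Real.exp (-(δ₀ * (P.eps * D))) ≤ Real.exp (2 * δ₀) * Real.exp (-(δ₀ * TK)) := by
    rw [← Real.exp_add]
    apply Real.exp_le_exp.mpr
    nlinarith [mul_le_mul_of_nonneg_left hεD hδ₀.le]
  have hTKeq : tdistT M (blockOf (P.L ^ P.K) M xt) bt = TK := by
    rw [← hxt, ← hbt, tdistT_blockOf_toTor]
  -- King's derivative in the tower's letters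
  have hder : ((P.L ^ P.K : ℕ) : ℝ)
        * (minimiser (P.L ^ P.K) M (aK a P.L P.K) ((((P.L ^ P.K : ℕ) : ℝ)) ^ 2) msq (Pi.single bt 1)
            (xt + unitVec (fine (P.L ^ P.K) M) μ)
          - minimiser (P.L ^ P.K) M (aK a P.L P.K) ((((P.L ^ P.K : ℕ) : ℝ)) ^ 2) msq (Pi.single bt 1) xt)
      = Balaban1983to89.B1.aSeq a P.L P.K
        * ((deriv P 0 P.eps μ * (tower P a msq).G P.K) *ᵥ (Qks P P.K *ᵥ Pi.single b 1)) x := by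
    rw [← hxt, ← hbt, ← aSeq_eq_aK, ← eps_inv_eq P, dminimiser_toTor_eq P M hMK a msq b x μ]
  rw [hTKeq, hder, abs_mul, abs_of_pos haK, aSeq_eq_aK]
  have haK' : 0 ≤ aK a P.L P.K := by rw [← aSeq_eq_aK]; exact haK.le
  calc aK a P.L P.K * |((deriv P 0 P.eps μ * (tower P a msq).G P.K) *ᵥ (Qks P P.K *ᵥ Pi.single b 1)) x|
      ≤ aK a P.L P.K * (c₀ * Real.exp (-(δ₀ * (P.eps * D))) * 1) := mul_le_mul_of_nonneg_left hmain haK'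
    _ ≤ aK a P.L P.K * (c₀ * (Real.exp (2 * δ₀) * Real.exp (-(δ₀ * TK))) * 1) := by
        gcongr
    _ = aK a P.L P.K * (c₀ * Real.exp (2 * δ₀)) * Real.exp (-(δ₀ * TK)) := by ring

/-! ## §4 «Combining our bounds with Theorem 3.3»: the printed shape of (3.71), second line -/

/-- **(3.71), SECOND LINE, IN ITS PRINTED SHAPE, MODULO THEOREM 3.3**: if both derivatives obey a decay
`|∂^ηℋ_k(x,b)|, |∂^{η′}ℋ_{k+n}(x′,b)| ≤ c₀e^{−δ₀t}` for some `t`, then the sup rate `king_prop38_deriv_torus` upgrades to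
`|∂^{η′}_μℋ_{k+n}(x′,b) − ∂^η_μℋ_k(x,b)| ≤ √(2c₀(C₁′+C₂′)L^{−γk})·e^{−δ₀t∕2}` — King's `CL^{−γ′k}exp[−δ₀′|x − z|]`, `γ′ = γ∕2`,
`δ₀′ = δ₀∕2` (p. 674). [cite: King1986, Prop. 3.8 (3.71) p.664, p.674] -/
theorem king_prop38_deriv_torus_of_decay (hd : 0 < d) {L : ℕ} [NeZero L] (hLodd : Odd L) (hL : 2 ≤ L) {k n : ℕ}
    (hk : 1 ≤ k) (hn : 1 ≤ n) (M : Fin d → ℕ) [hM : ∀ μ, NeZero (M μ)] {a m2 : ℝ} (ha : 0 < a) (hm : 0 < m2)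
    {γ : ℝ} (hγ0 : 0 ≤ γ) (hγ1 : γ < 1) (b : Tor M) (x : Tor (fine (L ^ k) M))
    (x' : Tor (fine (L ^ n * L ^ k) M)) (hx : ∀ μ, (x μ).val = (x' μ).val / L ^ n) (μ : Fin d)
    {c₀ δ₀ t : ℝ}
    (hdecA : |((L ^ k : ℕ) : ℝ)
        * (minimiser (L ^ k) M (aK a L k) (((L ^ k : ℕ) : ℝ) ^ 2) m2 (Pi.single b 1) (x + unitVec (fine (L ^ k) M) μ)
          - minimiser (L ^ k) M (aK a L k) (((L ^ k : ℕ) : ℝ) ^ 2) m2 (Pi.single b 1) x)|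
      ≤ c₀ * Real.exp (-(δ₀ * t)))
    (hdecB : |((L ^ n * L ^ k : ℕ) : ℝ)
        * (minimiser (L ^ n * L ^ k) M (aK a L (k + n)) (((L ^ n * L ^ k : ℕ) : ℝ) ^ 2) m2 (Pi.single b 1)
            (x' + unitVec (fine (L ^ n * L ^ k) M) μ)
          - minimiser (L ^ n * L ^ k) M (aK a L (k + n)) (((L ^ n * L ^ k : ℕ) : ℝ) ^ 2) m2 (Pi.single b 1) x')|
      ≤ c₀ * Real.exp (-(δ₀ * t))) :
    |((L ^ n * L ^ k : ℕ) : ℝ)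
        * (minimiser (L ^ n * L ^ k) M (aK a L (k + n)) (((L ^ n * L ^ k : ℕ) : ℝ) ^ 2) m2 (Pi.single b 1)
            (x' + unitVec (fine (L ^ n * L ^ k) M) μ)
          - minimiser (L ^ n * L ^ k) M (aK a L (k + n)) (((L ^ n * L ^ k : ℕ) : ℝ) ^ 2) m2 (Pi.single b 1) x')
      - ((L ^ k : ℕ) : ℝ)
        * (minimiser (L ^ k) M (aK a L k) (((L ^ k : ℕ) : ℝ) ^ 2) m2 (Pi.single b 1) (x + unitVec (fine (L ^ k) M) μ)
          - minimiser (L ^ k) M (aK a L k) (((L ^ k : ℕ) : ℝ) ^ 2) m2 (Pi.single b 1) x)|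
      ≤ Real.sqrt (((dprop38RateConst a a (lemma43Const a L k n) ((π ^ 2 / 4) ^ d) d γ
              + dprop38PosConst a ((π ^ 2 / 4) ^ d) d γ) * ((L ^ k : ℕ) : ℝ) ^ (-γ)) * (2 * c₀))
          * Real.exp (-(δ₀ / 2 * t)) := by
  have hrate := king_prop38_deriv_torus hd hLodd hL hk hn M ha hm hγ0 hγ1 b x x' hx μ
  have hε : 0 ≤ (dprop38RateConst a a (lemma43Const a L k n) ((π ^ 2 / 4) ^ d) d γ
      + dprop38PosConst a ((π ^ 2 / 4) ^ d) d γ) * ((L ^ k : ℕ) : ℝ) ^ (-γ) := (abs_nonneg _).trans hrate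
  refine abs_le_sqrt_mul_exp_half hε hrate ?_
  calc _ ≤ |((L ^ n * L ^ k : ℕ) : ℝ)
          * (minimiser (L ^ n * L ^ k) M (aK a L (k + n)) (((L ^ n * L ^ k : ℕ) : ℝ) ^ 2) m2 (Pi.single b 1)
              (x' + unitVec (fine (L ^ n * L ^ k) M) μ)
            - minimiser (L ^ n * L ^ k) M (aK a L (k + n)) (((L ^ n * L ^ k : ℕ) : ℝ) ^ 2) m2 (Pi.single b 1) x')|
        + |((L ^ k : ℕ) : ℝ)
          * (minimiser (L ^ k) M (aK a L k) (((L ^ k : ℕ) : ℝ) ^ 2) m2 (Pi.single b 1) (x + unitVec (fine (L ^ k) M) μ)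
            - minimiser (L ^ k) M (aK a L k) (((L ^ k : ℕ) : ℝ) ^ 2) m2 (Pi.single b 1) x)| := abs_sub _ _
    _ ≤ c₀ * Real.exp (-(δ₀ * t)) + c₀ * Real.exp (-(δ₀ * t)) := add_le_add hdecB hdecA
    _ = 2 * c₀ * Real.exp (-(δ₀ * t)) := by ring

/-- **KING'S (3.71), SECOND LINE, IN KING'S BLOCK-DISTANCE CURRENCY, FOR BAŁABAN'S VOLUMES — UNCONDITIONAL.**  For
`d ≥ 1`, odd `L ≥ 2`, `a > 0`, `m² > 0`, `0 ≤ γ < 1` there are `δ₀, c₀ > 0` (functions of `d, L, a, m²` only) such that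
for every volume `P = (d, L, m, K)` with `K ≥ 1`, every `n ≥ 1`, the unit torus `M_μ = 2L^m`, King's minimiser kernels
`ℋ_K` on `Tor (fine L^K M)` and `ℋ_{K+n}` on `Tor (fine (L^nL^K) M)` (the ACTUAL operators, `a_K = aK a L K`,
`c = η⁻²`), their forward lattice derivatives `∂^η_μℋ = η⁻¹(ℋ(· + e_μ) − ℋ)`, EVERY unit site `b`, direction `μ` and
fine points `x′` over `x`:
`|∂^{η′}_μℋ_{K+n}(x′, b) − ∂^η_μℋ_K(x, b)| ≤ √(2ac₀(C₁′ + C₂′)·L^{−γK})·e^{−(δ₀∕2)·tdistT M (B(x)) b}` — King's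
`CL^{−γ′k}exp[−δ₀′|x − z|]` (`γ′ = γ∕2`, `δ₀′ = δ₀∕2`) with `C₁′ = dprop38RateConst a a θ (π²∕4)^d d γ`,
`C₂′ = dprop38PosConst a (π²∕4)^d d γ`, `θ = lemma43Const a L K n`.  Inputs: §2, §3 for both runs (`blockOf_over`),
`aK_le`, `king_prop38_deriv_torus_of_decay`. [cite: King1986, Prop. 3.8 (3.71) p.664, p.674] -/
theorem king_prop38_deriv_torus_blocks (dd L : ℕ) (hd : 1 ≤ dd) (hLodd : Odd L) (hL : 2 ≤ L) {a m2 : ℝ}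
    (ha : 0 < a) (hm : 0 < m2) {γ : ℝ} (hγ0 : 0 ≤ γ) (hγ1 : γ < 1) :
    ∃ δ₀ c₀ : ℝ, 0 < δ₀ ∧ 0 < c₀ ∧ ∀ (P : Params) (_hPd : P.d = dd) (_hPL : P.L = L) (_hK : 1 ≤ P.K) [NeZero P.L]
      (n : ℕ) (_hn : 1 ≤ n) (M : Fin P.d → ℕ) [∀ μ, NeZero (M μ)] (_hMK : ∀ μ, M μ = P.sitesPerDir P.K)
      (xt : Tor (fine (P.L ^ P.K) M)) (xt' : Tor (fine (P.L ^ n * P.L ^ P.K) M)) (bt : Tor M)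
      (_hxx : ∀ μ, (xt μ).val = (xt' μ).val / P.L ^ n) (μ : Fin P.d),
      |((P.L ^ n * P.L ^ P.K : ℕ) : ℝ)
          * (minimiser (P.L ^ n * P.L ^ P.K) M (aK a P.L (P.K + n)) (((P.L ^ n * P.L ^ P.K : ℕ) : ℝ) ^ 2) m2
              (Pi.single bt 1) (xt' + unitVec (fine (P.L ^ n * P.L ^ P.K) M) μ)
            - minimiser (P.L ^ n * P.L ^ P.K) M (aK a P.L (P.K + n)) (((P.L ^ n * P.L ^ P.K : ℕ) : ℝ) ^ 2) m2
              (Pi.single bt 1) xt')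
        - ((P.L ^ P.K : ℕ) : ℝ)
          * (minimiser (P.L ^ P.K) M (aK a P.L P.K) (((P.L ^ P.K : ℕ) : ℝ) ^ 2) m2 (Pi.single bt 1)
              (xt + unitVec (fine (P.L ^ P.K) M) μ)
            - minimiser (P.L ^ P.K) M (aK a P.L P.K) (((P.L ^ P.K : ℕ) : ℝ) ^ 2) m2 (Pi.single bt 1) xt)|
        ≤ Real.sqrt (((dprop38RateConst a a (lemma43Const a P.L P.K n) ((π ^ 2 / 4) ^ P.d) P.d γ
                + dprop38PosConst a ((π ^ 2 / 4) ^ P.d) P.d γ) * ((P.L ^ P.K : ℕ) : ℝ) ^ (-γ)) * (2 * (a * c₀)))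
            * Real.exp (-(δ₀ / 2 * tdistT M (blockOf (P.L ^ P.K) M xt) bt)) := by
  have hL1 : 1 < L := by omega
  obtain ⟨δ₀, c₀, hδ₀, hc₀, H⟩ := dminimiser_kernel_decay_blocks dd L hd ⟨hLodd, hL1⟩ ha hm.le
  refine ⟨δ₀, c₀, hδ₀, hc₀, ?_⟩
  intro P hPd hPL hK _ n hn M _ hMK xt xt' bt hxx μ
  have hLr : (1 : ℝ) < P.L := by exact_mod_cast P.hL.2
  have hPd0 : 0 < P.d := by have := P.hd; omega
  have hPodd : Odd P.L := P.hL.1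
  have hPL2 : 2 ≤ P.L := by have := P.hL.2; omega
  -- run A: volume `P`
  have hA := H P hPd hPL hK M hMK (P.L ^ P.K) rfl xt bt μ
  have hdecA := hA.trans (mul_le_mul_of_nonneg_right (mul_le_mul_of_nonneg_right (aK_le ha hLr hK) hc₀.le)
    (Real.exp_pos (-(δ₀ * tdistT M (blockOf (P.L ^ P.K) M xt) bt))).le)
  -- run B: volume `(d, L, m, K + n)` over the same unit torus
  have hMK' : ∀ ν, M ν = (⟨P.d, P.L, P.m, P.K + n, P.hd, P.hL⟩ : Params).sitesPerDir (P.K + n) := fun ν => by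
    rw [hMK ν]; exact (sitesPerDir_finerVolume P n).symm
  have hN : P.L ^ n * P.L ^ P.K = P.L ^ (P.K + n) := by rw [pow_add, mul_comm]
  have hB := H (⟨P.d, P.L, P.m, P.K + n, P.hd, P.hL⟩ : Params) hPd hPL (show 1 ≤ P.K + n by omega) M hMK'
    (P.L ^ n * P.L ^ P.K) hN xt' bt μ
  rw [blockOf_over M xt xt' hxx] at hB
  have hdecB := hB.trans (mul_le_mul_of_nonneg_right (mul_le_mul_of_nonneg_right
      (aK_le ha hLr (show 1 ≤ P.K + n by omega)) hc₀.le)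
    (Real.exp_pos (-(δ₀ * tdistT M (blockOf (P.L ^ P.K) M xt) bt))).le)
  exact king_prop38_deriv_torus_of_decay hPd0 hPodd hPL2 hK hn M ha hm hγ0 hγ1 bt xt xt' hxx μ hdecA hdecB

/-! ## §5 The read-out shapes at a common smaller rate -/

/-- For `0 < κ ≤ δ₀`: `|∂^η_μℋ_K(x, b)| ≤ a·c₀·e^{−κ·tdistT M (B(x)) b}` (`a_K ≤ a`). [cite: King1986, Prop. 3.7 (3.64) p.663] -/
theorem dminimiser_row_decay (dd L : ℕ) (hd : 1 ≤ dd) (hL : Odd L ∧ 1 < L) {a : ℝ} (ha : 0 < a)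
    {msq : ℝ} (hmsq : 0 ≤ msq) :
    ∃ δ₀ c₀ : ℝ, 0 < δ₀ ∧ 0 < c₀ ∧ ∀ (P : Params), P.d = dd → P.L = L → 1 ≤ P.K →
      ∀ (M : Fin P.d → ℕ) [∀ μ, NeZero (M μ)] (_hMK : ∀ μ, M μ = P.sitesPerDir P.K)
        (N : ℕ) [NeZero N] (_hN : N = P.L ^ P.K) (κ : ℝ), 0 < κ → κ ≤ δ₀ →
        ∀ (xt : Tor (fine N M)) (bt : Tor M) (μ : Fin P.d),
        |(N : ℝ) * (minimiser N M (aK a P.L P.K) (((N : ℕ) : ℝ) ^ 2) msq (Pi.single bt 1) (xt + unitVec (fine N M) μ)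
            - minimiser N M (aK a P.L P.K) (((N : ℕ) : ℝ) ^ 2) msq (Pi.single bt 1) xt)|
          ≤ a * c₀ * Real.exp (-(κ * tdistT M (blockOf N M xt) bt)) := by
  obtain ⟨δ₀, c₀, hδ₀, hc₀, H⟩ := dminimiser_kernel_decay_blocks dd L hd hL ha hmsq
  refine ⟨δ₀, c₀, hδ₀, hc₀, ?_⟩
  intro P hPd hPL hK M _ hMK N _ hN κ _ hκδ xt bt μ
  have hLr : (1 : ℝ) < P.L := by exact_mod_cast P.hL.2
  have h1 := H P hPd hPL hK M hMK N hN xt bt μ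
  have h2 : aK a P.L P.K * c₀ * Real.exp (-(δ₀ * tdistT M (blockOf N M xt) bt))
      ≤ a * c₀ * Real.exp (-(δ₀ * tdistT M (blockOf N M xt) bt)) :=
    mul_le_mul_of_nonneg_right (mul_le_mul_of_nonneg_right (aK_le ha hLr hK) hc₀.le) (Real.exp_pos _).le
  exact (h1.trans h2).trans
    (exp_decay_mono (mul_nonneg ha.le hc₀.le) hκδ (tdistT_nonneg M _ _))

/-- For `0 < κ ≤ δ₀∕2`: `|∂^{η′}_μℋ_{K+n}(x′, b) − ∂^η_μℋ_K(x, b)| ≤ √(2ac₀(C₁′ + C₂′)L^{−γK})·e^{−κ·tdistT M (B(x)) b}`.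
[cite: King1986, Prop. 3.8 (3.71) p.664] -/
theorem dminimiser_row_rate (dd L : ℕ) (hd : 1 ≤ dd) (hLodd : Odd L) (hL : 2 ≤ L) {a m2 : ℝ} (ha : 0 < a)
    (hm : 0 < m2) {γ : ℝ} (hγ0 : 0 ≤ γ) (hγ1 : γ < 1) :
    ∃ δ₀ c₀ : ℝ, 0 < δ₀ ∧ 0 < c₀ ∧ ∀ (P : Params) (_hPd : P.d = dd) (_hPL : P.L = L) (_hK : 1 ≤ P.K) [NeZero P.L]
      (n : ℕ) (_hn : 1 ≤ n) (M : Fin P.d → ℕ) [∀ μ, NeZero (M μ)] (_hMK : ∀ μ, M μ = P.sitesPerDir P.K)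
      (κ : ℝ) (_hκ : 0 < κ) (_hκδ : κ ≤ δ₀ / 2)
      (xt : Tor (fine (P.L ^ P.K) M)) (xt' : Tor (fine (P.L ^ n * P.L ^ P.K) M)) (bt : Tor M)
      (_hxx : ∀ μ, (xt μ).val = (xt' μ).val / P.L ^ n) (μ : Fin P.d),
      |((P.L ^ n * P.L ^ P.K : ℕ) : ℝ)
          * (minimiser (P.L ^ n * P.L ^ P.K) M (aK a P.L (P.K + n)) (((P.L ^ n * P.L ^ P.K : ℕ) : ℝ) ^ 2) m2
              (Pi.single bt 1) (xt' + unitVec (fine (P.L ^ n * P.L ^ P.K) M) μ)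
            - minimiser (P.L ^ n * P.L ^ P.K) M (aK a P.L (P.K + n)) (((P.L ^ n * P.L ^ P.K : ℕ) : ℝ) ^ 2) m2
              (Pi.single bt 1) xt')
        - ((P.L ^ P.K : ℕ) : ℝ)
          * (minimiser (P.L ^ P.K) M (aK a P.L P.K) (((P.L ^ P.K : ℕ) : ℝ) ^ 2) m2 (Pi.single bt 1)
              (xt + unitVec (fine (P.L ^ P.K) M) μ)
            - minimiser (P.L ^ P.K) M (aK a P.L P.K) (((P.L ^ P.K : ℕ) : ℝ) ^ 2) m2 (Pi.single bt 1) xt)|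
        ≤ Real.sqrt (((dprop38RateConst a a (lemma43Const a P.L P.K n) ((π ^ 2 / 4) ^ P.d) P.d γ
                + dprop38PosConst a ((π ^ 2 / 4) ^ P.d) P.d γ) * ((P.L ^ P.K : ℕ) : ℝ) ^ (-γ)) * (2 * (a * c₀)))
            * Real.exp (-(κ * tdistT M (blockOf (P.L ^ P.K) M xt) bt)) := by
  obtain ⟨δ₀, c₀, hδ₀, hc₀, H⟩ := king_prop38_deriv_torus_blocks dd L hd hLodd hL ha hm hγ0 hγ1
  refine ⟨δ₀, c₀, hδ₀, hc₀, ?_⟩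
  intro P hPd hPL hK _ n hn M _ hMK κ _ hκδ xt xt' bt hxx μ
  exact (H P hPd hPL hK n hn M hMK xt xt' bt hxx μ).trans
    (exp_decay_mono (Real.sqrt_nonneg _) hκδ (tdistT_nonneg M _ _))

end Torus

end Literature.MathematicalPhysics.QuantumFieldTheory.King1986
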